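import Mathlib.Analysis.Complex.Basic
import Mathlib.Tactic
import HarnessLib

/-!
# Preliminaries for the Feder–Mihail inequality (bookkeeping of conditioned coefficient families)

Support file for the Sahi / Conjecture-P programme of route `PercNearOneGluingNoHeavy`
(`--supports stmt-CriticalPhenomena-4575`, prover prim-l12-p5 gen 31; proof note
`prim-l12-p5/MULTITYPE-PROOF-g31.md` §2).  No definitions, no named facts, no sorries.

For a real coefficient family `a : Finset σ → ℝ` ("unnormalised measure on `2^σ`") and a
coordinate `f`, conditioning on `f ∈ S` resp. `f ∉ S` produces the families
`S ↦ [f ∉ S]·a(S ∪ f)` and `S ↦ [f ∉ S]·a(S)` (the tree's convention, cf.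
`Literature.Combinatorics.StablePolynomials.InsertionFamilies/NegativeCorrelation`).  This file
collects the finite-sum identities relating the sums of `a`, `a·F`, restricted to `e ∈ S` /
`e ∉ S`, to those of the two conditioned families (the "eight cells" of the Feder–Mihail
induction), the identity `Σ_f Cov(X_f, F) = 0` for HOMOGENEOUS families, the elementary
four-cell inequality of the induction step, and the two degenerate cases and the point-mass case
of the induction.  The theorem itself is `…LowerTailFederMihail.feder_mihail`.

* `sum_cond_in`, `sum_cond_out`, `sum_split`, `sum_cond_in_filter`, `sum_cond_out_filter`,
  `sum_filter_split`, `cell_split` : re-indexing / splitting identities;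
* `influence_sum_zero` : `Σ_{f ∈ 𝔽} [(Σ_{S ∋ f} aF)(Σ a) − (Σ aF)(Σ_{S ∋ f} a)] = 0` (homogeneity);
* `four_cell` : the real inequality of the induction step;
* `fm_case_in_zero`, `fm_case_out_zero`, `fm_point_mass` : degenerate cases.
-/

namespace Summit.CriticalPhenomena.PercolationContinuityZ3.Theorems

namespace FederMihail

open Finset

variable {σ : Type*} [Fintype σ] [DecidableEq σ]

/-- Re-indexing along `S ↦ S ∪ {f}`: `Σ_S [f ∉ S] φ(S ∪ f) = Σ_{S ∋ f} φ(S)`. -/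
theorem sum_cond_in (f : σ) (φ : Finset σ → ℝ) :
    ∑ S : Finset σ, (if f ∈ S then 0 else φ (insert f S)) =
      ∑ S ∈ univ.filter (fun S : Finset σ => f ∈ S), φ S := by
  rw [← Finset.sum_filter_add_sum_filter_not univ (fun S : Finset σ => f ∈ S)]
  have h1 : ∑ S ∈ univ.filter (fun S : Finset σ => f ∈ S), (if f ∈ S then (0:ℝ) else φ (insert f S)) = 0 := by
    refine Finset.sum_eq_zero fun S hS => ?_
    rw [if_pos (Finset.mem_filter.1 hS).2]
  rw [h1, zero_add]
  refine Finset.sum_nbij' (fun S => insert f S) (fun S => S.erase f) ?_ ?_ ?_ ?_ ?_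
  · intro S hS
    simp only [Finset.mem_filter, Finset.mem_univ, true_and] at hS ⊢
    exact Finset.mem_insert_self f S
  · intro S hS
    simp only [Finset.mem_filter, Finset.mem_univ, true_and] at hS ⊢
    exact Finset.notMem_erase f S
  · intro S hS
    simp only [Finset.mem_filter, Finset.mem_univ, true_and] at hS
    exact Finset.erase_insert hS
  · intro S hS
    simp only [Finset.mem_filter, Finset.mem_univ, true_and] at hS
    exact Finset.insert_erase hS
  · intro S hS
    simp only [Finset.mem_filter, Finset.mem_univ, true_and] at hS
    rw [if_neg hS]

/-- `Σ_S [f ∉ S] φ(S) = Σ_{S ∌ f} φ(S)`. -/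
theorem sum_cond_out (f : σ) (φ : Finset σ → ℝ) :
    ∑ S : Finset σ, (if f ∈ S then 0 else φ S) =
      ∑ S ∈ univ.filter (fun S : Finset σ => f ∉ S), φ S := by
  rw [Finset.sum_filter]
  refine Finset.sum_congr rfl fun S _ => ?_
  by_cases h : f ∈ S <;> simp [h]

/-- Splitting a sum over all sets according to `f ∈ S`. -/
theorem sum_split (f : σ) (φ : Finset σ → ℝ) :
    ∑ S : Finset σ, φ S = ∑ S ∈ univ.filter (fun S : Finset σ => f ∈ S), φ S +
      ∑ S ∈ univ.filter (fun S : Finset σ => f ∉ S), φ S :=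
  (Finset.sum_filter_add_sum_filter_not univ (fun S : Finset σ => f ∈ S) φ).symm


/-- Re-indexing inside a filter by a predicate blind to `f`:
`Σ_{P(S)} [f ∉ S] φ(S ∪ f) = Σ_{P(S), f ∈ S} φ(S)`. -/
theorem sum_cond_in_filter (f : σ) (P : Finset σ → Prop) [DecidablePred P]
    (hP : ∀ S, P (insert f S) ↔ P S) (φ : Finset σ → ℝ) :
    ∑ S ∈ univ.filter P, (if f ∈ S then 0 else φ (insert f S)) =
      ∑ S ∈ univ.filter (fun S : Finset σ => P S ∧ f ∈ S), φ S := by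
  rw [Finset.sum_filter]
  have h1 : ∑ S : Finset σ, (if P S then (if f ∈ S then (0:ℝ) else φ (insert f S)) else 0) =
      ∑ S : Finset σ, (if f ∈ S then 0 else (if P (insert f S) then φ (insert f S) else 0)) := by
    refine Finset.sum_congr rfl fun S _ => ?_
    by_cases hf : f ∈ S
    · simp [hf]
    · have hiff := hP S
      by_cases hPS : P S
      · have hPi : P (insert f S) := hiff.2 hPS
        simp [hPS, hf, hPi]
      · have hPi : ¬ P (insert f S) := fun h => hPS (hiff.1 h)
        simp [hPS, hf, hPi]
  rw [h1, sum_cond_in f (fun S => if P S then φ S else 0), Finset.sum_filter, Finset.sum_filter]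
  refine Finset.sum_congr rfl fun S _ => ?_
  by_cases hf : f ∈ S <;> by_cases hPS : P S <;> simp [hf, hPS]

/-- `Σ_{P(S)} [f ∉ S] φ(S) = Σ_{P(S), f ∉ S} φ(S)`. -/
theorem sum_cond_out_filter (f : σ) (P : Finset σ → Prop) [DecidablePred P] (φ : Finset σ → ℝ) :
    ∑ S ∈ univ.filter P, (if f ∈ S then 0 else φ S) =
      ∑ S ∈ univ.filter (fun S : Finset σ => P S ∧ f ∉ S), φ S := by
  rw [Finset.sum_filter, Finset.sum_filter]
  refine Finset.sum_congr rfl fun S _ => ?_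
  by_cases hf : f ∈ S <;> by_cases hPS : P S <;> simp [hf, hPS]

/-- Splitting a filtered sum according to `f ∈ S`. -/
theorem sum_filter_split (f : σ) (P : Finset σ → Prop) [DecidablePred P] (φ : Finset σ → ℝ) :
    ∑ S ∈ univ.filter P, φ S = ∑ S ∈ univ.filter (fun S : Finset σ => P S ∧ f ∈ S), φ S +
      ∑ S ∈ univ.filter (fun S : Finset σ => P S ∧ f ∉ S), φ S := by
  rw [Finset.sum_filter, Finset.sum_filter, Finset.sum_filter, ← Finset.sum_add_distrib]
  refine Finset.sum_congr rfl fun S _ => ?_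
  by_cases hf : f ∈ S <;> by_cases hPS : P S <;> simp [hf, hPS]

/-- **`Σ_f Cov(X_f, F) = 0` for a homogeneous family** (unnormalised): if every set of non-zero
`b`-weight lies in `𝔽` and has cardinality `k`, then
`Σ_{f ∈ 𝔽} [ (Σ_{S ∋ f} b F)(Σ b) − (Σ b F)(Σ_{S ∋ f} b) ] = 0`, because
`Σ_f Σ_{S ∋ f} b(S) G(S) = k · Σ_S b(S) G(S)` for every `G`. -/
theorem influence_sum_zero (𝔽 : Finset σ) (b : Finset σ → ℝ) (k : ℕ)
    (hsupp : ∀ S, b S ≠ 0 → S ⊆ 𝔽) (hhom : ∀ S, b S ≠ 0 → S.card = k) (G : Finset σ → ℝ) :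
    ∑ f ∈ 𝔽, ((∑ S ∈ univ.filter (fun S : Finset σ => f ∈ S), b S * G S) * (∑ S, b S) -
        (∑ S, b S * G S) * (∑ S ∈ univ.filter (fun S : Finset σ => f ∈ S), b S)) = 0 := by
  have key : ∀ H : Finset σ → ℝ,
      ∑ f ∈ 𝔽, ∑ S ∈ univ.filter (fun S : Finset σ => f ∈ S), b S * H S = k * ∑ S, b S * H S := by
    intro H
    have h1 : ∀ f, ∑ S ∈ univ.filter (fun S : Finset σ => f ∈ S), b S * H S =
        ∑ S : Finset σ, (if f ∈ S then b S * H S else 0) := fun f => Finset.sum_filter _ _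
    simp only [h1]
    rw [Finset.sum_comm, Finset.mul_sum]
    refine Finset.sum_congr rfl fun S _ => ?_
    rw [Finset.sum_ite_mem, Finset.sum_const]
    by_cases hb : b S = 0
    · simp [hb]
    · rw [Finset.inter_eq_right.2 (hsupp S hb), hhom S hb, nsmul_eq_mul]
  rw [Finset.sum_sub_distrib, ← Finset.sum_mul, ← Finset.mul_sum, key G]
  have h2 := key (fun _ => 1)
  simp only [mul_one] at h2
  rw [h2]
  ring

/-- **The elementary inequality of the induction step.**  With the eight cell sums of the proof of
`feder_mihail` (`x,y` = `F`-weighted, `u,v` = plain; index `1/0` = `f ∈ S / f ∉ S`; `x,u` for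
`e ∈ S`, `y,v` for `e ∉ S`): the two induction hypotheses, the pairwise negative correlation of
`e, f` and the non-negative influence of `f` (with `v₀ > 0`) give
`(x₁ + x₀)(v₁ + v₀) ≤ (y₁ + y₀)(u₁ + u₀)`. -/
theorem four_cell (x₁ x₀ y₁ y₀ u₁ u₀ v₁ v₀ : ℝ) (hu₁ : 0 ≤ u₁) (hv₁ : 0 ≤ v₁) (hv₀ : 0 < v₀)
    (hx₁ : u₁ = 0 → x₁ = 0) (hy₁ : v₁ = 0 → y₁ = 0)
    (ih₁ : x₁ * v₁ ≤ y₁ * u₁) (ih₀ : x₀ * v₀ ≤ y₀ * u₀)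
    (pnc : u₁ * v₀ ≤ u₀ * v₁) (pi : y₀ * v₁ ≤ y₁ * v₀) :
    (x₁ + x₀) * (v₁ + v₀) ≤ (y₁ + y₀) * (u₁ + u₀) := by
  rcases eq_or_lt_of_le hv₁ with hv | hv
  · -- v₁ = 0: then y₁ = 0, u₁ = 0, x₁ = 0
    have hy : y₁ = 0 := hy₁ hv.symm
    have hu : u₁ = 0 := by
      rw [← hv, mul_zero] at pnc
      nlinarith
    have hx : x₁ = 0 := hx₁ hu
    subst hy; subst hu; subst hx
    rw [← hv]
    nlinarith
  · -- v₁ > 0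
    have h1 : x₁ * v₁ * (v₀ * (v₁ + v₀)) ≤ y₁ * u₁ * (v₀ * (v₁ + v₀)) :=
      mul_le_mul_of_nonneg_right ih₁ (by positivity)
    have h2 : x₀ * v₀ * (v₁ * (v₁ + v₀)) ≤ y₀ * u₀ * (v₁ * (v₁ + v₀)) :=
      mul_le_mul_of_nonneg_right ih₀ (by positivity)
    have h3 : 0 ≤ (u₀ * v₁ - u₁ * v₀) * (y₁ * v₀ - y₀ * v₁) :=
      mul_nonneg (by linarith) (by linarith)
    have hvv : 0 < v₀ * v₁ := mul_pos hv₀ hv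
    -- (goal) * (v₀ v₁) holds; divide
    have h4 : (x₁ + x₀) * (v₁ + v₀) * (v₀ * v₁) ≤ (y₁ + y₀) * (u₁ + u₀) * (v₀ * v₁) := by
      nlinarith [h1, h2, h3]
    exact le_of_mul_le_mul_right h4 hvv

/-- The degenerate case `a(S) = 0` whenever `e ∈ S`: both `e`-sums vanish. -/
theorem fm_case_in_zero (e : σ) (a F : Finset σ → ℝ) (hA : ∀ S, e ∈ S → a S = 0) :
    (∑ S ∈ univ.filter (fun S : Finset σ => e ∈ S), a S * F S) * (∑ S, a S) ≤
      (∑ S, a S * F S) * (∑ S ∈ univ.filter (fun S : Finset σ => e ∈ S), a S) := by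
  have h1 : ∑ S ∈ univ.filter (fun S : Finset σ => e ∈ S), a S * F S = 0 :=
    Finset.sum_eq_zero fun S hS => by rw [hA S (Finset.mem_filter.1 hS).2, zero_mul]
  have h2 : ∑ S ∈ univ.filter (fun S : Finset σ => e ∈ S), a S = 0 :=
    Finset.sum_eq_zero fun S hS => hA S (Finset.mem_filter.1 hS).2
  rw [h1, h2, zero_mul, mul_zero]

/-- The degenerate case `a(S) = 0` whenever `e ∉ S`: both sides coincide. -/
theorem fm_case_out_zero (e : σ) (a F : Finset σ → ℝ) (hB : ∀ S, e ∉ S → a S = 0) :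
    (∑ S ∈ univ.filter (fun S : Finset σ => e ∈ S), a S * F S) * (∑ S, a S) ≤
      (∑ S, a S * F S) * (∑ S ∈ univ.filter (fun S : Finset σ => e ∈ S), a S) := by
  have h1 : ∑ S ∈ univ.filter (fun S : Finset σ => e ∈ S), a S * F S = ∑ S, a S * F S := by
    rw [Finset.sum_filter]
    refine Finset.sum_congr rfl fun S _ => ?_
    by_cases h : e ∈ S
    · rw [if_pos h]
    · rw [if_neg h, hB S h, zero_mul]
  have h2 : ∑ S ∈ univ.filter (fun S : Finset σ => e ∈ S), a S = ∑ S, a S := by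
    rw [Finset.sum_filter]
    refine Finset.sum_congr rfl fun S _ => ?_
    by_cases h : e ∈ S
    · rw [if_pos h]
    · rw [if_neg h, hB S h]
  rw [h1, h2, mul_comm]

/-- **The eight cells.**  For `f ≠ e`, the sums of `a` and of `a·F` over `{S ∋ e}` and over
`{S ∌ e}` split according to `f ∈ S` (re-indexed by `S ↦ S ∖ f`) and `f ∉ S`. -/
theorem cell_split (e f : σ) (hfe : f ≠ e) (a F : Finset σ → ℝ) :
    (∑ S ∈ univ.filter (fun S : Finset σ => e ∈ S), a S =
      ∑ S ∈ univ.filter (fun S : Finset σ => e ∈ S), (if f ∈ S then 0 else a (insert f S)) +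
      ∑ S ∈ univ.filter (fun S : Finset σ => e ∈ S), (if f ∈ S then 0 else a S)) ∧
    (∑ S ∈ univ.filter (fun S : Finset σ => e ∉ S), a S =
      ∑ S ∈ univ.filter (fun S : Finset σ => e ∉ S), (if f ∈ S then 0 else a (insert f S)) +
      ∑ S ∈ univ.filter (fun S : Finset σ => e ∉ S), (if f ∈ S then 0 else a S)) ∧
    (∑ S ∈ univ.filter (fun S : Finset σ => e ∈ S), a S * F S =
      ∑ S ∈ univ.filter (fun S : Finset σ => e ∈ S),
          (if f ∈ S then 0 else a (insert f S)) * F (insert f S) +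
      ∑ S ∈ univ.filter (fun S : Finset σ => e ∈ S), (if f ∈ S then 0 else a S) * F S) ∧
    (∑ S ∈ univ.filter (fun S : Finset σ => e ∉ S), a S * F S =
      ∑ S ∈ univ.filter (fun S : Finset σ => e ∉ S),
          (if f ∈ S then 0 else a (insert f S)) * F (insert f S) +
      ∑ S ∈ univ.filter (fun S : Finset σ => e ∉ S), (if f ∈ S then 0 else a S) * F S) := by
  have hPin : ∀ S : Finset σ, e ∈ insert f S ↔ e ∈ S := fun S => by
    rw [Finset.mem_insert]; exact ⟨fun h => h.resolve_left hfe.symm, Or.inr⟩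
  have hPout : ∀ S : Finset σ, e ∉ insert f S ↔ e ∉ S := fun S => (hPin S).not
  have key : ∀ (P : Finset σ → Prop) [DecidablePred P], (∀ S, P (insert f S) ↔ P S) →
      ∀ φ : Finset σ → ℝ, ∑ S ∈ univ.filter P, φ S =
        ∑ S ∈ univ.filter P, (if f ∈ S then 0 else φ (insert f S)) +
        ∑ S ∈ univ.filter P, (if f ∈ S then 0 else φ S) := by
    intro P _ hP φ
    rw [sum_cond_in_filter f P hP φ, sum_cond_out_filter f P φ, sum_filter_split f P φ]
  refine ⟨key _ hPin a, key _ hPout a, ?_, ?_⟩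
  · rw [key _ hPin (fun S => a S * F S)]
    congr 1 <;> (refine Finset.sum_congr rfl fun S _ => ?_; split_ifs <;> simp)
  · rw [key _ hPout (fun S => a S * F S)]
    congr 1 <;> (refine Finset.sum_congr rfl fun S _ => ?_; split_ifs <;> simp)

/-- **The point-mass case of the Feder–Mihail induction.**  If the part of `a` avoiding `e` is
carried by the single set `𝔽.erase e`, then every `S ∋ e` of non-zero weight is `𝔽 ∖ g` for one
`g`, the swap property gives `F(S) ≤ F(𝔽.erase e)`, and the inequality follows. -/
theorem fm_point_mass (𝔽 : Finset σ) (e : σ) (a F : Finset σ → ℝ) (k : ℕ)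
    (ha0 : ∀ S, 0 ≤ a S) (hsupp : ∀ S, a S ≠ 0 → S ⊆ 𝔽) (hhom : ∀ S, a S ≠ 0 → S.card = k)
    (hswap : ∀ S, a S ≠ 0 → e ∈ S → ∀ g ∈ 𝔽, g ∉ S → F S ≤ F (insert g (S.erase e)))
    (he𝔽 : e ∈ 𝔽) (hpt : ∀ S, e ∉ S → a S ≠ 0 → S = 𝔽.erase e) :
    (∑ S ∈ univ.filter (fun S : Finset σ => e ∈ S), a S * F S) * (∑ S, a S) ≤
      (∑ S, a S * F S) * (∑ S ∈ univ.filter (fun S : Finset σ => e ∈ S), a S) := by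
  set S₀ := 𝔽.erase e with hS₀
  have heS₀ : e ∉ S₀ := by rw [hS₀]; exact Finset.notMem_erase e 𝔽
  have hout : ∑ S ∈ univ.filter (fun S : Finset σ => e ∉ S), a S = a S₀ := by
    refine Finset.sum_eq_single S₀ (fun S hS hne => ?_) (fun h => absurd ?_ h)
    · by_contra h; exact hne (hpt S (Finset.mem_filter.1 hS).2 h)
    · exact Finset.mem_filter.2 ⟨Finset.mem_univ _, heS₀⟩
  have houtF : ∑ S ∈ univ.filter (fun S : Finset σ => e ∉ S), a S * F S = a S₀ * F S₀ := by
    refine Finset.sum_eq_single S₀ (fun S hS hne => ?_) (fun h => absurd ?_ h)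
    · have : a S = 0 := by by_contra h; exact hne (hpt S (Finset.mem_filter.1 hS).2 h)
      rw [this, zero_mul]
    · exact Finset.mem_filter.2 ⟨Finset.mem_univ _, heS₀⟩
  rw [sum_split e a, sum_split e (fun S => a S * F S), hout, houtF]
  have ha00 : 0 ≤ a S₀ := ha0 S₀
  -- `F S ≤ F S₀` on the support of the `e`-part (or `a S₀ = 0`)
  have hdom : ∑ S ∈ univ.filter (fun S : Finset σ => e ∈ S), a S * F S ≤
      F S₀ * ∑ S ∈ univ.filter (fun S : Finset σ => e ∈ S), a S ∨ a S₀ = 0 := by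
    by_cases haS₀ : a S₀ = 0
    · exact Or.inr haS₀
    left
    have hk : k + 1 = 𝔽.card := by
      have := hhom S₀ haS₀
      rw [hS₀, Finset.card_erase_of_mem he𝔽] at this
      have : 0 < 𝔽.card := Finset.card_pos.2 ⟨e, he𝔽⟩
      omega
    rw [Finset.mul_sum]
    refine Finset.sum_le_sum fun S hS => ?_
    have heS : e ∈ S := (Finset.mem_filter.1 hS).2
    by_cases haS : a S = 0
    · rw [haS]; simp
    rw [mul_comm]
    refine mul_le_mul_of_nonneg_right ?_ (ha0 S)
    -- the unique `g ∈ 𝔽 \ S`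
    have hSsub : S ⊆ 𝔽 := hsupp S haS
    have hdiff : (𝔽 \ S).card = 1 := by
      rw [Finset.card_sdiff_of_subset hSsub, hhom S haS]; omega
    obtain ⟨g, hg⟩ := Finset.card_eq_one.1 hdiff
    have hg' : g ∈ 𝔽 \ S := by rw [hg]; exact Finset.mem_singleton_self g
    have hg𝔽 : g ∈ 𝔽 := (Finset.mem_sdiff.1 hg').1
    have hgS : g ∉ S := (Finset.mem_sdiff.1 hg').2
    have hins : insert g (S.erase e) = S₀ := by
      rw [hS₀]
      ext x
      simp only [Finset.mem_insert, Finset.mem_erase]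
      constructor
      · rintro (rfl | ⟨hxe, hxS⟩)
        · exact ⟨fun h => hgS (h ▸ heS), hg𝔽⟩
        · exact ⟨hxe, hSsub hxS⟩
      · rintro ⟨hxe, hx𝔽⟩
        by_cases hxS : x ∈ S
        · exact Or.inr ⟨hxe, hxS⟩
        · left
          have : x ∈ 𝔽 \ S := Finset.mem_sdiff.2 ⟨hx𝔽, hxS⟩
          rw [hg] at this
          exact Finset.mem_singleton.1 this
    have := hswap S haS heS g hg𝔽 hgS
    rwa [hins] at this
  rcases hdom with hdom | hdom
  · nlinarith [hdom, ha00]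
  · rw [hdom]; nlinarith

end FederMihail

end Summit.CriticalPhenomena.PercolationContinuityZ3.Theorems
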